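import Mathlib.Algebra.Category.Grp.AB
import Mathlib.Algebra.Category.Grp.Ulift
import Mathlib.AlgebraicGeometry.Sites.EtalePoint
import Mathlib.CategoryTheory.Abelian.GrothendieckCategory.HasExt
import Mathlib.CategoryTheory.Sites.Point.Skyscraper
import Mathlib.CategoryTheory.Sites.SheafCohomology.Basic
import Mathlib.Algebra.Homology.DerivedCategory.Ext.EnoughProjectives
import Mathlib.Algebra.Category.Grp.ForgetCorepresentable
import Mathlib.Algebra.Category.Grp.EpiMono
import HarnessLib

/-!
# Étale cohomology of a separably closed field (Milne II Thm. 1.9, III Example 1.7 (a))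

For a separably closed field `K`, the small étale site of `Spec K` has trivial cohomology:
`Hⁿ⁺¹((Spec K)_ét, F) = 0` for every abelian sheaf `F`, and `H⁰((Spec K)_ét, F) = F(Spec K)`;
for the constant sheaf on an abelian group `M`, `H⁰ ≅ M`. Printed source: Milne II Thm. 1.9
(sheaves on `(Spec K)_et` ↔ discrete `Gal(K_sep/K)`-modules; II §2, book p. 53 = held copy
p. 67: "the functor `F ↦ F(x̄)` gives an equivalence of categories between `S(x̄_et)` and `Ab`")
and III Example 1.7 (a): `Hⁱ(X, F) = Hⁱ(G, M)` for `X = spec K`, `G = Gal(K_sep/K)` — here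
`G = 1`. The equivalence `S(x̄_et) ≃ Ab` itself is `sheafSpecEquivalence`.

Everything is **proved**, on Mathlib's carriers (`Scheme.Etale`, `Scheme.smallEtaleTopology`,
`Sheaf.H`), using Mathlib's points of the étale topos (`Scheme.pointSmallEtale`) and fibre
functors of points of sites (`GrothendieckTopology.Point.sheafFiber`, exact and a left adjoint):

* `isTerminalEtaleMkId` — `S` is a final object of `S.Etale`;
* `isInitialSpecFiberPt` — for `S = Spec K`, `K` separably closed, the category of elements of
  the fibre functor of the tautological geometric point `𝟙 : Spec K → Spec K` has the initial
  object `(Spec K, 𝟙)`; hence the stalk at this point **is** the global-sections functor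
  (`sheafSectionsIsoSheafFiber`), so `Γ(Spec K, –)` preserves epimorphisms;
* `preservesFiniteLimits_sheafSections_spec`, `preservesFiniteColimits_sheafSections_spec` —
  `Γ(Spec K, –)` is exact;
* `projective_constantSheaf_spec` — consequently the constant sheaf `ℤ` (left adjoint image of
  the projective `ℤ`) is projective, and
* `subsingleton_etaleCohomology_spec_succ` / `_of_pos` — `Hⁱ((Spec K)_ét, F)` is trivial for
  all `F` and `i > 0` (Mathlib `Ext.subsingleton_of_projective`): `cd(K) = 0`;
* `constantSheafSectionsSpecIso` — `(constantSheaf M)(Spec K) ≅ M`, whence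
  `etaleCohomologyZeroSpecAddEquiv : H⁰((Spec K)_ét, M) ≃+ M`;
* `finite_etaleCohomology_spec` — all `Hⁱ((Spec K)_ét, M)` are finite for `M` finite: the case
  `Y = Spec K` of the named fact
  `Literature.AlgebraicGeometry.Motives.finite_etaleCohomology_of_isProper`
  (`EllAdicComparison.lean`, Milne VI Cor. 2.8), the dimension-`0` base case ("The theorem is
  obvious for `n = 0`", proof of Milne VI Thm. 1.1);
* `isIso_skyscraperSheafAdjunction_counit_app`, `isIso_skyscraperSheafAdjunction_unit_app`,
  `sheafSpecEquivalence` — **Milne II Thm. 1.9 for `K` separably closed**: Mathlib's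
  stalk ⊣ skyscraper adjunction at the tautological point is an equivalence
  `Sheaf((Spec K)_ét, Ab) ≌ Ab`, whose functor is `Γ(Spec K, –)` up to isomorphism
  (`sheafSpecEquivalenceFunctorIso`); the unit is inverted using that the single tautological
  point is a conservative family (`isConservativeFamilyOfPoints_specPoint`, from Mathlib's
  `Scheme.isConservative_pointSmallEtale`).

## References

* J. S. Milne, *Étale cohomology*, Princeton (reissue 2025): II Thm. 1.9, II §2 (stalks,
  held copy p. 67), III Example 1.7 (a) (held copy p. 95), VI Thm. 1.1, VI Cor. 2.8. [Milne2025]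

## Design notes

* The point is Mathlib's `Scheme.pointSmallEtale (𝟙 (Spec K))`, whose fibre functor is
  `X ↦ (Spec K →_{Spec K} X)` (sections). Its category of elements has the initial object
  `(Spec K, 𝟙)`, so the filtered colimit defining the stalk is evaluation at `Spec K`
  (`isIso_ι_of_isTerminal`); no new notion is introduced.
* `Prop`-valued instances (`IsIso`, `PreservesEpimorphisms`, `Projective`) are stated as theorems
  and installed locally with `haveI`, not as global instances.
-/

universe u

open CategoryTheory CategoryTheory.Limits Opposite AlgebraicGeometry

noncomputable section

namespace Literature.AlgebraicGeometry.Motives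

/-! ### The final object of the small étale site -/

/-- `S` itself, with its identity, is a final object of the small étale site `S.Etale`
(`Over.mk (𝟙 S)` is final in `Over S`, and the fully faithful `Etale.forget S` reflects this).
[folklore] -/
def isTerminalEtaleMkId (S : Scheme.{u}) : IsTerminal (Scheme.Etale.mk (𝟙 S) : S.Etale) :=
  IsTerminal.isTerminalOfObj (Scheme.Etale.forget S) (Scheme.Etale.mk (𝟙 S)) Over.mkIdTerminal

/-! ### The tautological geometric point of `Spec K`, `K` separably closed -/

section Point

variable (K : Type u) [Field K] [IsSepClosed K]

/-- The tautological geometric point `𝟙 : Spec K → Spec K` of `Spec K` (`K` separably closed),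
as a point of the small étale site (Mathlib `Scheme.pointSmallEtale`); its fibre functor sends
an étale `Spec K`-scheme `X` to its set of sections `Spec K →_{Spec K} X`.
[cite: Milne2025, II §2 (geometric points and stalks)] -/
abbrev specPoint : (Spec (.of K)).smallEtaleTopology.Point :=
  Scheme.pointSmallEtale (𝟙 (Spec (.of K)))

/-- The final object `Spec K` of `(Spec K).Etale`. [folklore] -/
abbrev specTop : (Spec (.of K)).Etale := Scheme.Etale.mk (𝟙 (Spec (.of K)))

/-- The tautological section `𝟙` of `Spec K` over itself, an element of the fibre of
`specPoint K` at the final object. [folklore] -/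
def specTopPt : (specPoint K).fiber.obj (specTop K) :=
  𝟙 (Over.mk (𝟙 (Spec (CommRingCat.of K))))

/-- The fibre functor of the tautological point transports the tautological section along
`f : Spec K ⟶ X` to the section underlying `f`. [folklore] -/
@[simp]
theorem specPoint_fiber_map_specTopPt {X : (Spec (.of K)).Etale} (f : specTop K ⟶ X) :
    (specPoint K).fiber.map f (specTopPt K) = (Scheme.Etale.forget _).map f := by
  change 𝟙 _ ≫ (Scheme.Etale.forget _).map f = _
  simp

/-- `(Spec K, 𝟙)` is an initial object of the category of elements of the fibre functor of the
tautological point: a section `x : Spec K → X` is the same as a morphism `Spec K ⟶ X` in the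
site. [folklore] -/
def isInitialSpecFiberPt :
    IsInitial ((specPoint K).fiber.elementsMk (specTop K) (specTopPt K)) :=
  IsInitial.ofUniqueHom
    (fun e => ⟨(Scheme.Etale.forget _).preimage
        (show (Scheme.Etale.forget _).obj (specTop K) ⟶ (Scheme.Etale.forget _).obj e.1 from e.2),
        by simp⟩)
    fun e g => by
      ext : 1
      apply (Scheme.Etale.forget _).map_injective
      rw [Functor.map_preimage]
      have h := g.2
      rw [specPoint_fiber_map_specTopPt] at h
      exact h

/-- The stalk at the tautological point is evaluation at `Spec K`: the canonical map
`P(Spec K) → P_{x̄}` into the filtered colimit is an isomorphism, the index category having the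
final object `(Spec K, 𝟙)ᵒᵖ`. [cite: Milne2025, II §2 (geometric points and stalks)] -/
theorem isIso_toPresheafFiber_specTop (P : (Spec (.of K)).Etaleᵒᵖ ⥤ Ab.{u}) :
    IsIso ((specPoint K).toPresheafFiber (specTop K) (specTopPt K) P) :=
  isIso_ι_of_isTerminal (terminalOpOfInitial (isInitialSpecFiberPt K))
    ((CategoryOfElements.π (specPoint K).fiber).op ⋙ P)

/-- **Global sections = stalk at the tautological point** on `(Spec K)_ét`, `K` separably
closed: `Γ(Spec K, –) ≅ (specPoint K).sheafFiber` as functors `Sheaf → Ab`.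
[cite: Milne2025, II Thm. 1.9 and II §2] -/
def sheafSectionsIsoSheafFiber :
    (sheafSections (Spec (.of K)).smallEtaleTopology Ab.{u}).obj (op (specTop K)) ≅
      (specPoint K).sheafFiber :=
  NatIso.ofComponents
    (fun F => @asIso _ _ _ _ ((specPoint K).toPresheafFiber (specTop K) (specTopPt K) F.obj)
      (isIso_toPresheafFiber_specTop K F.obj))
    fun f => ((specPoint K).toPresheafFiber_naturality f.hom (specTop K) (specTopPt K)).symm

/-- `Γ(Spec K, –) : Sheaf((Spec K)_ét, Ab) → Ab` preserves epimorphisms (it is isomorphic to a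
stalk functor, which is a left adjoint). [cite: Milne2025, II Thm. 1.9] -/
theorem preservesEpimorphisms_sheafSections_spec :
    ((sheafSections (Spec (.of K)).smallEtaleTopology Ab.{u}).obj
      (op (specTop K))).PreservesEpimorphisms :=
  Functor.preservesEpimorphisms.of_iso (sheafSectionsIsoSheafFiber K).symm

/-- `Γ(Spec K, –) : Sheaf((Spec K)_ét, Ab) → Ab` is right exact (preserves finite colimits), being
isomorphic to a stalk functor. [cite: Milne2025, II Thm. 1.9] -/
theorem preservesFiniteColimits_sheafSections_spec :
    PreservesFiniteColimits ((sheafSections (Spec (.of K)).smallEtaleTopology Ab.{u}).obj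
      (op (specTop K))) :=
  preservesFiniteColimits_of_natIso (sheafSectionsIsoSheafFiber K).symm

/-- `Γ(Spec K, –) : Sheaf((Spec K)_ét, Ab) → Ab` is left exact (preserves finite limits), being
isomorphic to a stalk functor; with `preservesFiniteColimits_sheafSections_spec` it is exact,
the formal content of "`S(x̄_et) ≃ Ab`" used in Milne III §1. [cite: Milne2025, II Thm. 1.9] -/
theorem preservesFiniteLimits_sheafSections_spec :
    PreservesFiniteLimits ((sheafSections (Spec (.of K)).smallEtaleTopology Ab.{u}).obj
      (op (specTop K))) :=
  preservesFiniteLimits_of_natIso (sheafSectionsIsoSheafFiber K).symm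

/-- `ℤ` (as `ULift ℤ`) is a projective object of `Ab`: it corepresents the forgetful functor,
which preserves epimorphisms. [folklore] -/
theorem projective_uliftInt : Projective (AddCommGrpCat.of (ULift.{u} ℤ) : Ab.{u}) :=
  (Projective.projective_iff_preservesEpimorphisms_coyoneda_obj _).2
    (Functor.preservesEpimorphisms.of_iso AddCommGrpCat.coyonedaObjIsoForget.symm)

/-- On `(Spec K)_ét`, `K` separably closed, the constant sheaf `ℤ` is **projective**: it is the
image of the projective `ℤ` under the left adjoint `constantSheaf ⊣ Γ(Spec K, –)` whose right
adjoint preserves epimorphisms. [cite: Milne2025, II Thm. 1.9] -/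
theorem projective_constantSheaf_spec :
    Projective ((constantSheaf (Spec (.of K)).smallEtaleTopology Ab.{u}).obj
      (AddCommGrpCat.of (ULift.{u} ℤ))) :=
  haveI := preservesEpimorphisms_sheafSections_spec K
  (constantSheafAdj _ Ab.{u} (isTerminalEtaleMkId _)).map_projective _ projective_uliftInt

/-- **Milne III Example 1.7 (a), separably closed case: `Hⁿ⁺¹((Spec K)_ét, F) = 0`.** For `K`
separably closed and any abelian sheaf `F` on the small étale site of `Spec K`, Mathlib's
`Sheaf.H F (n + 1) = Extⁿ⁺¹(ℤ, F)` is trivial (the constant sheaf `ℤ` being projective).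
Printed: `Hⁱ(X, F) = Hⁱ(G, M)` with `G = Gal(K_sep/K) = 1`.
[cite: Milne2025, III Example 1.7 (a)] -/
theorem subsingleton_etaleCohomology_spec_succ
    (F : Sheaf (Spec (.of K)).smallEtaleTopology Ab.{u}) (n : ℕ) :
    Subsingleton (F.H (n + 1)) :=
  haveI := projective_constantSheaf_spec K
  Abelian.Ext.subsingleton_of_projective _ _ n

/-- **`cd(K) = 0` for `K` separably closed**, in the shape of Milne VI Thm. 1.1 with `dim = 0`:
`Hⁱ((Spec K)_ét, F)` is trivial for every `i > 0 = 2 · dim (Spec K)` and every abelian sheaf `F`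
("The theorem is obvious for `n = 0`", proof of VI Thm. 1.1).
[cite: Milne2025, III Example 1.7 (a) and VI Thm. 1.1] -/
theorem subsingleton_etaleCohomology_spec_of_pos
    (F : Sheaf (Spec (.of K)).smallEtaleTopology Ab.{u}) {i : ℕ} (hi : 0 < i) :
    Subsingleton (F.H i) := by
  obtain ⟨n, rfl⟩ := Nat.exists_eq_add_one_of_ne_zero hi.ne'
  exact subsingleton_etaleCohomology_spec_succ K F n

/-- `H⁰((Spec K)_ét, F) ≃+ F(Spec K)` (Mathlib `Sheaf.H.equiv₀` at the final object `Spec K`).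
[cite: Milne2025, III Example 1.7 (a)] -/
def etaleCohomologyZeroSpecAddEquivSections
    (F : Sheaf (Spec (.of K)).smallEtaleTopology Ab.{u}) :
    F.H 0 ≃+ F.obj.obj (op (specTop K)) :=
  Sheaf.H.equiv₀ F (isTerminalEtaleMkId _)

/-- The sections over `Spec K` of the constant sheaf on `M` are `M` (`K` separably closed):
`(constantSheaf M)(Spec K) ≅ M_{x̄} ≅ (const M)_{x̄} ≅ M`, the stalk of a sheafification being
the stalk of the presheaf. [cite: Milne2025, II Thm. 1.9 and II §2] -/
def constantSheafSectionsSpecIso (M : Ab.{u}) :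
    ((constantSheaf (Spec (.of K)).smallEtaleTopology Ab.{u}).obj M).obj.obj (op (specTop K)) ≅
      M :=
  (sheafSectionsIsoSheafFiber K).app _ ≪≫
    ((specPoint K).presheafToSheafCompSheafFiberIso Ab.{u}).app ((Functor.const _).obj M) ≪≫
    (@asIso _ _ _ _ ((specPoint K).toPresheafFiber (specTop K) (specTopPt K)
      ((Functor.const _).obj M)) (isIso_toPresheafFiber_specTop K _)).symm

/-- **`H⁰((Spec K)_ét, M) ≃+ M`** for `K` separably closed and any abelian group `M`.
[cite: Milne2025, III Example 1.7 (a)] -/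
def etaleCohomologyZeroSpecAddEquiv (M : Ab.{u}) :
    ((constantSheaf (Spec (.of K)).smallEtaleTopology Ab.{u}).obj M).H 0 ≃+ M :=
  (etaleCohomologyZeroSpecAddEquivSections K _).trans
    (constantSheafSectionsSpecIso K M).addCommGroupIsoToAddEquiv

/-- **The case `Y = Spec K` of Milne VI Cor. 2.8** (proved): for `K` separably closed and `M`
a finite abelian group, every `Hⁱ((Spec K)_ét, M)` is finite (`≅ M` for `i = 0`, trivial for
`i > 0`). This is `finite_etaleCohomology_of_isProper` for `Y = Spec K → Spec K`.
[cite: Milne2025, III Example 1.7 (a) and VI Cor. 2.8] -/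
theorem finite_etaleCohomology_spec (M : Ab.{u}) [Finite M] (i : ℕ) :
    Finite (((constantSheaf (Spec (.of K)).smallEtaleTopology Ab.{u}).obj M).H i) := by
  cases i with
  | zero => exact Finite.of_equiv M (etaleCohomologyZeroSpecAddEquiv K M).symm.toEquiv
  | succ n =>
    haveI := subsingleton_etaleCohomology_spec_succ K
      ((constantSheaf (Spec (.of K)).smallEtaleTopology Ab.{u}).obj M) n
    infer_instance

/-! ### `Sheaf((Spec K)_ét, Ab) ≌ Ab` (Milne II Thm. 1.9, separably closed case) -/

/-- The counit `(sky M)_{x̄} → M` of Mathlib's stalk ⊣ skyscraper adjunction at the tautological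
point is an isomorphism: precomposed with the isomorphism `(sky M)(Spec K) ≅ (sky M)_{x̄}` it is
the projection of `∏_{sections of Spec K} M` onto its unique factor. [folklore] -/
theorem isIso_skyscraperSheafAdjunction_counit_app (M : Ab.{u}) :
    IsIso (X := (specPoint K).sheafFiber.obj ((specPoint K).skyscraperSheaf M)) (Y := M)
      (((specPoint K).skyscraperSheafAdjunction (A := Ab.{u})).counit.app M) := by
  letI : Unique ((specPoint K).fiber.obj (specTop K)) :=
    (specPoint K).uniqueFiberObj (specTop K) (isTerminalEtaleMkId _)
  have e1 := (specPoint K).toPresheafFiber_skyscraperPresheafHomEquiv_symm (A := Ab.{u})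
    (𝟙 ((specPoint K).skyscraperPresheaf M)) (specTop K) (specTopPt K)
  have e2 : (((specPoint K).skyscraperSheafAdjunction (A := Ab.{u})).homEquiv _ _).symm
      (𝟙 ((specPoint K).skyscraperSheaf M)) =
      (specPoint K).skyscraperPresheafHomEquiv.symm (𝟙 ((specPoint K).skyscraperPresheaf M)) :=
    (specPoint K).skyscraperSheafAdjunction_homEquiv_symm_apply (A := Ab.{u})
      (𝟙 ((specPoint K).skyscraperSheaf M))
  have e3 := ((specPoint K).skyscraperSheafAdjunction (A := Ab.{u})).homEquiv_symm_id M
  have hπ : IsIso (Pi.π (fun _ : (specPoint K).fiber.obj (specTop K) => M) (specTopPt K)) := by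
    rw [Subsingleton.elim (specTopPt K) default, ← productUniqueIso_hom]
    infer_instance
  haveI := isIso_toPresheafFiber_specTop K ((specPoint K).skyscraperPresheaf M)
  have hh : IsIso ((𝟙 ((specPoint K).skyscraperPresheaf (A := Ab.{u}) M) : _ ⟶ _).app
      (op (specTop K)) ≫
      Pi.π (fun _ : (specPoint K).fiber.obj (specTop K) => M) (specTopPt K)) := by
    simp only [NatTrans.id_app, Category.id_comp]
    exact hπ
  have h4 := IsIso.of_isIso_fac_left (hh := hh) e1
  rw [← e3, e2]
  exact h4

/-- The tautological point alone is a conservative family of points of `(Spec K)_ét`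
(Mathlib `Scheme.isConservative_pointSmallEtale`: its image is all of `Spec K`). [folklore] -/
theorem isConservativeFamilyOfPoints_specPoint :
    (ObjectProperty.ofObj fun _ : PUnit.{u + 1} => specPoint K).IsConservativeFamilyOfPoints :=
  Scheme.isConservative_pointSmallEtale (fun _ : PUnit.{u + 1} => 𝟙 (Spec (.of K))) (by
    ext x
    simp)

/-- The unit `F → sky(F_{x̄})` of the stalk ⊣ skyscraper adjunction at the tautological point is
an isomorphism: by the triangle identity its stalk is a one-sided inverse of the (invertible)
counit, and the tautological point is conservative. [cite: Milne2025, II Thm. 1.9] -/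
theorem isIso_skyscraperSheafAdjunction_unit_app
    (F : Sheaf (Spec (.of K)).smallEtaleTopology Ab.{u}) :
    IsIso (((specPoint K).skyscraperSheafAdjunction (A := Ab.{u})).unit.app F) := by
  rw [((isConservativeFamilyOfPoints_specPoint K).jointlyReflectIsomorphisms Ab.{u}).isIso_iff]
  rintro ⟨_, ⟨⟩⟩
  have w : (specPoint K).sheafFiber.map
      (((specPoint K).skyscraperSheafAdjunction (A := Ab.{u})).unit.app F) ≫
      ((specPoint K).skyscraperSheafAdjunction (A := Ab.{u})).counit.app
        ((specPoint K).sheafFiber.obj F) = 𝟙 ((specPoint K).sheafFiber.obj F) :=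
    ((specPoint K).skyscraperSheafAdjunction (A := Ab.{u})).left_triangle_components F
  dsimp only [Functor.id_obj, Functor.comp_obj] at w
  refine @IsIso.of_isIso_fac_right _ _ _ _ _ _ _ _ ?_ ?_ w
  · exact isIso_skyscraperSheafAdjunction_counit_app K ((specPoint K).sheafFiber.obj F)
  · exact IsIso.id _

/-- **Milne II Thm. 1.9, separably closed case: `Sheaf((Spec K)_ét, Ab) ≌ Ab`.** For `K`
separably closed, taking the stalk at the tautological geometric point (equivalently, global
sections over `Spec K`, `sheafSectionsIsoSheafFiber`) is an equivalence of categories from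
abelian sheaves on the small étale site of `Spec K` to abelian groups, with quasi-inverse the
skyscraper (= constant) sheaf. Printed: `S(X_et) ≃ G-mod`, `G = Gal(K_sep/K)`; "the functor
`F ↦ F(x̄)` gives an equivalence of categories between `S(x̄_et)` and `Ab`" (II §2).
[cite: Milne2025, II Thm. 1.9] -/
def sheafSpecEquivalence : Sheaf (Spec (.of K)).smallEtaleTopology Ab.{u} ≌ Ab.{u} :=
  @Adjunction.toEquivalence _ _ _ _ _ _ ((specPoint K).skyscraperSheafAdjunction (A := Ab.{u}))
    (isIso_skyscraperSheafAdjunction_unit_app K) (isIso_skyscraperSheafAdjunction_counit_app K)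

/-- The equivalence `sheafSpecEquivalence` is the stalk functor at the tautological point
(by construction). [folklore] -/
theorem sheafSpecEquivalence_functor :
    (sheafSpecEquivalence K).functor = (specPoint K).sheafFiber := rfl

/-- The equivalence `Sheaf((Spec K)_ét, Ab) ≌ Ab` is, up to isomorphism, the global-sections
functor `Γ(Spec K, –)`. [cite: Milne2025, II Thm. 1.9] -/
def sheafSpecEquivalenceFunctorIso :
    (sheafSpecEquivalence K).functor ≅
      (sheafSections (Spec (.of K)).smallEtaleTopology Ab.{u}).obj (op (specTop K)) :=
  (sheafSectionsIsoSheafFiber K).symm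

end Point

end Literature.AlgebraicGeometry.Motives

end
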